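import Summits.ResolutionOfSingularities.ResolutionOfSingularities.Theorems.NearExitTau
import Summits.ResolutionOfSingularities.ResolutionOfSingularities.Theorems.NearExitRational
import Summits.ResolutionOfSingularities.ResolutionOfSingularities.Theorems.NearExitTransfer
import Summits.ResolutionOfSingularities.ResolutionOfSingularities.Theorems.HilbertSamuelEliminationSigmaMaxModificationsCorridor3WLadderIsoTailsEmbeddedStep

/-!
# Near exit — chart auxiliaries (campaign «NearExit», g33, file 10)

Auxiliaries for the chart theorem (`NearExitChart`): invariance of `𝔫_w` / `Persists` under unit scaling of the
direction lift; the translation automorphism of a polynomial ring; residues in the Rees chart ring modulo a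
prime containing all `e_k − ŵ_k`; and the two facts about a RATIONAL point `𝔴 ∋ e_k w_{ij} − w_{ik}` of the
exceptional divisor of the chart `S = R[c/c_j]`: the translated chart coordinates `(c_j, e_k − ŵ_k)_{k ≠ j}` form
a regular system of parameters of `S_𝔴` (Literature `isRsopPart_chartFamily` with the translated presentation of
`S/(c_j)`), and `S_𝔴` has the same residue field as `R`.

Sources: [StacksProject] Tags 052Q, 0BIQ, 00NQ; [CossartPiltant2008] §4; [Hironaka1970] §2.
-/

open IsLocalRing MvPolynomial
open Literature.AlgebraicGeometry.Resolution
open Summit.ResolutionOfSingularities.ResolutionOfSingularities.Theorems.PinchTower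

namespace Summit.ResolutionOfSingularities.ResolutionOfSingularities.Theorems.NearExit

/-! ## Small generic helpers -/

section Helpers

/-- Parts of regular systems of parameters only depend on the set of members. [folklore] -/
theorem isRsopPart_of_range_eq {A : Type} [CommRing A] [IsLocalRing A] {n : ℕ} {z z' : Fin n → A}
    (hz : IsRsopPart z) (h : Set.range z' = Set.range z) : IsRsopPart z' := by
  obtain ⟨hR, e, y, hdim, hspan⟩ := hz
  exact ⟨hR, e, y, hdim, by rw [h]; exact hspan⟩

/-- `range ![a, b] = range ![b, a]`. [folklore] -/
theorem range_pair_comm {A : Type} (a b : A) : Set.range ![a, b] = Set.range ![b, a] := by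
  ext x
  simp only [Set.mem_range, Fin.exists_fin_two, Matrix.cons_val_zero, Matrix.cons_val_one,
    Matrix.cons_val_fin_one]
  exact or_comm

variable {R : Type} [CommRing R] [IsLocalRing R] {d : ℕ} (c : Fin (d + 1) → R)

/-- Scaling a direction lift shrinks `𝔫_w`. [this campaign] -/
theorem nIdeal_mul_le (w : Fin (d + 1) → R) (u : R) :
    VeryNearCutClasses.nIdeal c (fun k => w k * u) ≤ VeryNearCutClasses.nIdeal c w := by
  unfold VeryNearCutClasses.nIdeal
  refine sup_le_sup_right ?_ _
  rw [Ideal.span_le]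
  rintro _ ⟨a, b, rfl⟩
  have : w a * u * c b - w b * u * c a = u * (w a * c b - w b * c a) := by ring
  rw [SetLike.mem_coe, this]
  exact Ideal.mul_mem_left _ _ (Ideal.subset_span ⟨a, b, rfl⟩)

/-- `𝔫_w` is invariant under scaling the lift by a unit. [this campaign] -/
theorem nIdeal_mul_unit (w : Fin (d + 1) → R) {u : R} (hu : IsUnit u) :
    VeryNearCutClasses.nIdeal c (fun k => w k * u) = VeryNearCutClasses.nIdeal c w := by
  refine le_antisymm (nIdeal_mul_le c w u) ?_
  obtain ⟨v, hv⟩ := hu.exists_right_inv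
  have h : VeryNearCutClasses.nIdeal c (fun k => w k * u * v) ≤ VeryNearCutClasses.nIdeal c (fun k => w k * u) :=
    nIdeal_mul_le c _ v
  have hw : (fun k => w k * u * v) = w := funext fun k => by rw [mul_assoc, hv, mul_one]
  rwa [hw] at h

/-- `Persists` only depends on `𝔫_w`. [this campaign] -/
theorem persists_iff_of_nIdeal_eq {w w' : Fin (d + 1) → R}
    (h : VeryNearCutClasses.nIdeal c w = VeryNearCutClasses.nIdeal c w') (t : R) (J : Ideal R) (n : ℕ) :
    VeryNearCutClasses.Persists c w t J n ↔ VeryNearCutClasses.Persists c w' t J n := by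
  unfold VeryNearCutClasses.Persists VeryNearCutClasses.qIdeal
  rw [h]

end Helpers

/-! ## The translation automorphism `X_k ↦ X_k − a_k` -/

section Translate

variable {K : Type} [CommRing K] {ι : Type} (a : ι → K)

/-- Translation of the variables by constants, as a `K`-algebra automorphism. DEFINITION (support, data).
[folklore] -/
noncomputable def translate : MvPolynomial ι K ≃ₐ[K] MvPolynomial ι K :=
  AlgEquiv.ofAlgHom (aeval fun k => X k - C (a k)) (aeval fun k => X k + C (a k))
    (by ext k; simp) (by ext k; simp)

/-- `translate a (C r) = C r`. [folklore] -/
theorem translate_C (r : K) : translate a (C r) = C r := by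
  show aeval _ (C r) = C r
  rw [aeval_C, MvPolynomial.algebraMap_eq]

/-- `translate a (X k) = X k − C (a k)`. [folklore] -/
theorem translate_X (k : ι) : translate a (X k) = X k - C (a k) :=
  aeval_X _ k

end Translate

/-! ## Residues in the chart ring -/

section ChartRing

variable {R : Type} [CommRing R] {d : ℕ} (c : Fin (d + 1) → R)

/-- Every element of the chart ring is congruent to an element of `R` modulo a prime containing all
`e_k − ŵ_k`. [folklore] -/
theorem exists_sub_chartBase_mem (j : Fin (d + 1)) (𝔴 : Ideal (chartRing c j))
    (hK : chartBase c j (c j) ∈ 𝔴) (ŵ : Fin (d + 1) → R) (hŵ : ∀ k, chartGen c j k - chartBase c j (ŵ k) ∈ 𝔴)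
    (a : chartRing c j) : ∃ r : R, a - chartBase c j r ∈ 𝔴 := by
  obtain ⟨p, hp⟩ := quotient_comp_eval₂Hom_surjective c j (Ideal.Quotient.mk _ a)
  refine ⟨MvPolynomial.eval (fun k : {k : Fin (d + 1) // k ≠ j} => ŵ k.1) p, ?_⟩
  rw [RingHom.comp_apply, Ideal.Quotient.eq] at hp
  -- `a ≡ p(e) (mod c_j)` and `p(e) ≡ p(ŵ) (mod 𝔴)`
  have h1 : a - MvPolynomial.eval₂Hom (chartBase c j) (fun k : {k : Fin (d + 1) // k ≠ j} => chartGen c j k.1) p ∈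
      𝔴 := by
    have h2 := Ideal.mul_mem_left 𝔴 (-1) ((Ideal.span_le.mpr (Set.singleton_subset_iff.mpr hK)) hp)
    have h3 : (-1 : chartRing c j) * (MvPolynomial.eval₂Hom (chartBase c j)
        (fun k : {k : Fin (d + 1) // k ≠ j} => chartGen c j k.1) p - a) =
        a - MvPolynomial.eval₂Hom (chartBase c j) (fun k : {k : Fin (d + 1) // k ≠ j} => chartGen c j k.1) p := by
      ring
    rw [h3] at h2; exact h2
  have h4 : ∀ q : MvPolynomial {k : Fin (d + 1) // k ≠ j} R,
      MvPolynomial.eval₂Hom (chartBase c j) (fun k : {k : Fin (d + 1) // k ≠ j} => chartGen c j k.1) q -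
        chartBase c j (MvPolynomial.eval (fun k : {k : Fin (d + 1) // k ≠ j} => ŵ k.1) q) ∈ 𝔴 := by
    intro q
    induction q using MvPolynomial.induction_on with
    | C r =>
      have e : MvPolynomial.eval₂Hom (chartBase c j) (fun k : {k : Fin (d + 1) // k ≠ j} => chartGen c j k.1)
          (C r) - chartBase c j (MvPolynomial.eval (fun k : {k : Fin (d + 1) // k ≠ j} => ŵ k.1) (C r)) = 0 := by
        rw [MvPolynomial.eval₂Hom_C, MvPolynomial.eval_C]; ring
      rw [e]; exact 𝔴.zero_mem
    | add p q hp hq =>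
      have e : MvPolynomial.eval₂Hom (chartBase c j) (fun k : {k : Fin (d + 1) // k ≠ j} => chartGen c j k.1)
          (p + q) - chartBase c j (MvPolynomial.eval (fun k : {k : Fin (d + 1) // k ≠ j} => ŵ k.1) (p + q)) =
          (MvPolynomial.eval₂Hom (chartBase c j) (fun k : {k : Fin (d + 1) // k ≠ j} => chartGen c j k.1) p -
            chartBase c j (MvPolynomial.eval (fun k : {k : Fin (d + 1) // k ≠ j} => ŵ k.1) p)) +
          (MvPolynomial.eval₂Hom (chartBase c j) (fun k : {k : Fin (d + 1) // k ≠ j} => chartGen c j k.1) q -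
            chartBase c j (MvPolynomial.eval (fun k : {k : Fin (d + 1) // k ≠ j} => ŵ k.1) q)) := by
        rw [map_add, map_add, map_add]; ring
      rw [e]; exact 𝔴.add_mem hp hq
    | mul_X p k hp =>
      have e : MvPolynomial.eval₂Hom (chartBase c j) (fun k : {k : Fin (d + 1) // k ≠ j} => chartGen c j k.1)
          (p * X k) - chartBase c j (MvPolynomial.eval (fun k : {k : Fin (d + 1) // k ≠ j} => ŵ k.1) (p * X k)) =
          (MvPolynomial.eval₂Hom (chartBase c j) (fun k : {k : Fin (d + 1) // k ≠ j} => chartGen c j k.1) p -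
            chartBase c j (MvPolynomial.eval (fun k : {k : Fin (d + 1) // k ≠ j} => ŵ k.1) p)) * chartGen c j k.1 +
          chartBase c j (MvPolynomial.eval (fun k : {k : Fin (d + 1) // k ≠ j} => ŵ k.1) p) *
            (chartGen c j k.1 - chartBase c j (ŵ k.1)) := by
        rw [map_mul, map_mul, map_mul, MvPolynomial.eval₂Hom_X', MvPolynomial.eval_X]; ring
      rw [e]; exact 𝔴.add_mem (Ideal.mul_mem_right _ _ hp) (Ideal.mul_mem_left _ _ (hŵ k.1))
  have h5 := 𝔴.add_mem h1 (h4 p)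
  have h6 : a - MvPolynomial.eval₂Hom (chartBase c j) (fun k : {k : Fin (d + 1) // k ≠ j} => chartGen c j k.1) p +
      (MvPolynomial.eval₂Hom (chartBase c j) (fun k : {k : Fin (d + 1) // k ≠ j} => chartGen c j k.1) p -
        chartBase c j (MvPolynomial.eval (fun k : {k : Fin (d + 1) // k ≠ j} => ŵ k.1) p)) =
      a - chartBase c j (MvPolynomial.eval (fun k : {k : Fin (d + 1) // k ≠ j} => ŵ k.1) p) := by ring
  rw [h6] at h5; exact h5

/-- Transport of `c_k = c_j · e_k` to a ring under the chart: `σ(c_k) = σ(c_j)·χ(e_k)`. [folklore] -/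
theorem sigma_apply_eq (j : Fin (d + 1)) {L : Type} [CommRing L] (σ : R →+* L) (χ : chartRing c j →+* L)
    (hχ : ∀ r, χ (chartBase c j r) = σ r) (k : Fin (d + 1)) : σ (c k) = σ (c j) * χ (chartGen c j k) := by
  rw [← hχ (c k), reesChartBase_apply_eq_mul_chartGen c j k, map_mul, hχ]

/-- Transport of the chart face element `G^{♯}(0, e₁, …)` to a ring under the chart. [folklore] -/
theorem chi_face_eq (j : Fin (d + 1)) {L : Type} [CommRing L] (σ : R →+* L) (χ : chartRing c j →+* L)
    (hχ : ∀ r, χ (chartBase c j r) = σ r) (G : MvPolynomial (Fin (d + 1)) R) :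
    χ (MvPolynomial.eval (Function.update (chartGen c j) 0 0) (MvPolynomial.map (chartBase c j) G)) =
      MvPolynomial.eval (Function.update (fun k => χ (chartGen c j k)) 0 0) (MvPolynomial.map σ G) := by
  classical
  rw [map_eval_eq_eval_map χ, MvPolynomial.map_map]
  have hστ : χ.comp (chartBase c j) = σ := RingHom.ext hχ
  have hfun : (χ ∘ Function.update (chartGen c j) 0 0) = Function.update (fun k => χ (chartGen c j k)) 0 0 := by
    funext k
    by_cases hk : k = 0
    · subst hk; simp only [Function.comp_apply, Function.update_self, map_zero]
    · simp only [Function.comp_apply, Function.update_of_ne hk]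
  rw [hστ, hfun]

end ChartRing

/-! ## Rational points of the exceptional divisor of a chart -/

section RationalPoint

variable {R : Type} [CommRing R] [IsRegularLocalRing R] {d : ℕ} (c : Fin (d + 1) → R)
  (hc : Ideal.span (Set.range c) = maximalIdeal R) (hd : (maximalIdeal R).spanFinrank = d + 1)

-- WRITER NOTE (g16, dedup.landed p837315): `span_append_elim0` deleted — it restated the landed
-- `Cruxes.SigmaMaxModifications.IdeasL1C5.EmbeddedStep.span_range_append_elim0`, cited by name below.
include hd in
/-- `emb.dim R = (d + 1) + 0`. [folklore] -/
theorem spanFinrank_eq_add_zero : (maximalIdeal R).spanFinrank = (d + 1) + 0 := by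
  rw [hd, Nat.add_zero]

/-- At a prime `𝔴 ∋ e_k·w_j − w_k` (all `k`) with `w_j` a unit: `e_k ≡ w_k w_j⁻¹ (mod 𝔴)`. [folklore] -/
theorem chartGen_sub_mem (j : Fin (d + 1)) (𝔴 : Ideal (chartRing c j)) [𝔴.IsPrime]
    (h𝔴 : 𝔴.comap (chartBase c j) = maximalIdeal R) {wd : Fin (d + 1) → R} (hunit : IsUnit (wd j))
    (hall : ∀ k, chartGen c j k * chartBase c j (wd j) - chartBase c j (wd k) ∈ 𝔴) {υ : R}
    (hυ : wd j * υ = 1) (k : Fin (d + 1)) : chartGen c j k - chartBase c j (wd k * υ) ∈ 𝔴 := by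
  have hwj : chartBase c j (wd j) ∉ 𝔴 := fun h => by
    have h' : wd j ∈ maximalIdeal R := by rw [← h𝔴, Ideal.mem_comap]; exact h
    exact (IsLocalRing.mem_maximalIdeal _).mp h' hunit
  have eR : wd k * υ * wd j = wd k := by rw [mul_assoc, mul_comm υ, hυ, mul_one]
  have e := (chartBase c j).map_mul (wd k * υ) (wd j)
  rw [eR] at e
  -- `e : cB (wd k) = cB (wd k υ) · cB (wd j)`
  have hD : (chartGen c j k - chartBase c j (wd k * υ)) * chartBase c j (wd j) ∈ 𝔴 := by
    have hD' : (chartGen c j k - chartBase c j (wd k * υ)) * chartBase c j (wd j) =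
        chartGen c j k * chartBase c j (wd j) - chartBase c j (wd k) := by
      rw [e]; ring
    rw [hD']; exact hall k
  exact ((‹𝔴.IsPrime›).mem_or_mem hD).resolve_right hwj

/-- If moreover `e_k ∈ 𝔴` then `ŵ_k ∈ 𝔪_R`. [folklore] -/
theorem mem_maximalIdeal_of_chartGen_mem (j : Fin (d + 1)) (𝔴 : Ideal (chartRing c j))
    (h𝔴 : 𝔴.comap (chartBase c j) = maximalIdeal R) (ŵ : Fin (d + 1) → R)
    (hcBw : ∀ k, chartGen c j k - chartBase c j (ŵ k) ∈ 𝔴) {k : Fin (d + 1)} (hk : chartGen c j k ∈ 𝔴) :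
    ŵ k ∈ maximalIdeal R := by
  rw [← h𝔴, Ideal.mem_comap]
  have h3 : chartBase c j (ŵ k) = chartGen c j k - (chartGen c j k - chartBase c j (ŵ k)) := by ring
  rw [h3]; exact 𝔴.sub_mem hk (hcBw k)

include hc hd in
/-- At a prime `𝔴 ∋ e₀` of the chart `j ≠ 0` over `𝔪_R`, the pair `(χ e₀, σ c_j)` is part of a regular system of
parameters of `S_𝔴`. [cite: StacksProject, Tag 0BIQ] -/
theorem isRsopPart_pair (j : Fin (d + 1)) (𝔴 : Ideal (chartRing c j)) [𝔴.IsPrime]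
    (h𝔴 : 𝔴.comap (chartBase c j) = maximalIdeal R)
    (L : Type) [CommRing L] [IsLocalRing L] (σ : R →+* L) (χ : chartRing c j →+* L)
    (hχ : ∀ r, χ (chartBase c j r) = σ r) (hloc : @IsLocalization.AtPrime _ _ L _ χ.toAlgebra 𝔴 _)
    (hj0 : (0 : Fin (d + 1)) ≠ j) (he0 : chartGen c j 0 ∈ 𝔴) :
    IsRsopPart ![χ (chartGen c j 0), σ (c j)] := by
  letI alg : Algebra (chartRing c j) L := χ.toAlgebra
  haveI : IsLocalization.AtPrime L 𝔴 := hloc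
  have halg : ∀ w, algebraMap (chartRing c j) L w = χ w := fun w => by rw [RingHom.algebraMap_toAlgebra]
  have hz0 :=
    Summit.ResolutionOfSingularities.ResolutionOfSingularities.Cruxes.SigmaMaxModifications.IdeasL1C5.EmbeddedStep.span_range_append_elim0 c hc
  have hd0 := spanFinrank_eq_add_zero (R := R) hd
  have hfam := isRsopPart_chartFamily_reesChart c j (Fin.elim0 : Fin 0 → R) hz0 hd0 𝔴 h𝔴 L (a := 1)
    (fun _ => (⟨0, hj0⟩ : {k : Fin (d + 1) // k ≠ j})) (Function.injective_of_subsingleton _) (fun _ => he0)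
  have hpair : chartFamily c j (Fin.elim0 : Fin 0 → R) L (chartBase c j) (chartGen c j)
      (fun _ : Fin 1 => (⟨0, hj0⟩ : {k : Fin (d + 1) // k ≠ j})) = (![σ (c j), χ (chartGen c j 0)] : Fin 2 → L) := by
    funext k
    induction k using Fin.cases with
    | zero => simp only [chartFamily, Fin.cons_zero, halg, hχ, Matrix.cons_val_zero]
    | succ k =>
      simp only [chartFamily, Fin.cons_succ, Matrix.cons_val_succ, Matrix.cons_val_fin_one]
      exact (Fin.append_left _ _ k).trans (halg _)
  rw [hpair] at hfam
  exact isRsopPart_of_range_eq hfam (range_pair_comm _ _)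

include hc hd in
/-- **Rational point, I.**  At a prime `𝔴` of the chart over `𝔪_R` containing all `e_k − ŵ_k`, the family
`(σ c_j ; χ(e_k) − σ ŵ_k)_{k ≠ j}` (with `0 ↦ σ c_j` at the slot `j`) is part of a regular system of parameters
of `S_𝔴`.  [cite: StacksProject, Tags 052Q, 0BIQ] -/
theorem isRsopPart_rational (j : Fin (d + 1)) (𝔴 : Ideal (chartRing c j)) [𝔴.IsPrime]
    (h𝔴 : 𝔴.comap (chartBase c j) = maximalIdeal R)
    (L : Type) [CommRing L] [IsLocalRing L] (σ : R →+* L) (χ : chartRing c j →+* L)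
    (hχ : ∀ r, χ (chartBase c j r) = σ r) (hloc : @IsLocalization.AtPrime _ _ L _ χ.toAlgebra 𝔴 _)
    (ŵ : Fin (d + 1) → R) (hcBw : ∀ k, chartGen c j k - chartBase c j (ŵ k) ∈ 𝔴) :
    IsRsopPart (Function.update (fun k => χ (chartGen c j k) - σ (ŵ k)) j (σ (c j))) := by
  classical
  letI alg : Algebra (chartRing c j) L := χ.toAlgebra
  haveI : IsLocalization.AtPrime L 𝔴 := hloc
  haveI : IsNoetherianRing (chartRing c j) := isNoetherianRing_blowupChart c j
  have halg : ∀ w, algebraMap (chartRing c j) L w = χ w := fun w => by rw [RingHom.algebraMap_toAlgebra]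
  have hz0 :=
    Summit.ResolutionOfSingularities.ResolutionOfSingularities.Cruxes.SigmaMaxModifications.IdeasL1C5.EmbeddedStep.span_range_append_elim0 c hc
  have hd0 := spanFinrank_eq_add_zero (R := R) hd
  have hqr : IsQuasiRegular c := isQuasiRegular_centre c (Fin.elim0 : Fin 0 → R) hz0 hd0
  -- the translated presentation of `S/(c_j)`
  let ε : MvPolynomial {k : Fin (d + 1) // k ≠ j} (R ⧸ Ideal.span (Set.range c)) ≃+*
      chartRing c j ⧸ Ideal.span {chartBase c j (c j)} :=
    (translate fun k : {k : Fin (d + 1) // k ≠ j} =>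
      Ideal.Quotient.mk (Ideal.span (Set.range c)) (ŵ k.1)).toRingEquiv.trans (chartQuotEquiv c j hqr)
  have hεC : ∀ r : R, ε (C (Ideal.Quotient.mk (Ideal.span (Set.range c)) r)) =
      Ideal.Quotient.mk _ (chartBase c j r) := fun r => by
    show chartQuotEquiv c j hqr (translate _ (C (Ideal.Quotient.mk (Ideal.span (Set.range c)) r))) = _
    rw [translate_C, chartQuotEquiv_apply, chartQuotMap_C]
  have hεX : ∀ k : {k : Fin (d + 1) // k ≠ j}, ε (X k) =
      Ideal.Quotient.mk _ ((fun k => chartGen c j k - chartBase c j (ŵ k)) k.1) := fun k => by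
    show chartQuotEquiv c j hqr (translate _ (X k)) = _
    rw [translate_X, chartQuotEquiv_apply, map_sub, chartQuotMap_X, chartQuotMap_C]
    exact (map_sub (Ideal.Quotient.mk (Ideal.span {chartBase c j (c j)})) _ _).symm
  have hjJ : Function.Injective (fun k : Fin d => finSuccAboveEquiv j k) := (finSuccAboveEquiv j).injective
  have hfamR := isRsopPart_chartFamily c j (Fin.elim0 : Fin 0 → R) hz0 hd0 L (chartBase c j)
    (fun k => chartGen c j k - chartBase c j (ŵ k))
    (reesChartBase_mem_nonZeroDivisors (c j) (Ideal.mem_span_range_self (f := c) (x := j)))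
    ε hεC hεX 𝔴 h𝔴 (fun k : Fin d => finSuccAboveEquiv j k) hjJ (fun k => hcBw _)
  have hfam_eq : chartFamily c j (Fin.elim0 : Fin 0 → R) L (chartBase c j)
      (fun k => chartGen c j k - chartBase c j (ŵ k)) (fun k : Fin d => finSuccAboveEquiv j k) =
      (Fin.cons (σ (c j)) (fun k : Fin d => χ (chartGen c j (j.succAbove k)) - σ (ŵ (j.succAbove k))) :
        Fin (d + 1) → L) := by
    funext l
    induction l using Fin.cases with
    | zero => simp only [chartFamily, Fin.cons_zero, halg, hχ]
    | succ k =>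
      simp only [chartFamily, Fin.cons_succ]
      refine (Fin.append_left _ _ k).trans ?_
      rw [halg]
      simp only [finSuccAboveEquiv_apply]
      have e := map_sub χ (chartGen c j (j.succAbove k)) (chartBase c j (ŵ (j.succAbove k)))
      rw [hχ] at e
      exact e
  rw [hfam_eq] at hfamR
  refine isRsopPart_of_range_eq hfamR ?_
  ext a
  constructor
  · rintro ⟨l, rfl⟩
    by_cases hl : l = j
    · subst hl; exact ⟨0, by rw [Fin.cons_zero, Function.update_self]⟩
    · obtain ⟨k, rfl⟩ := Fin.exists_succAbove_eq hl
      exact ⟨k.succ, by rw [Fin.cons_succ, Function.update_of_ne (Fin.succAbove_ne j k)]⟩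
  · rintro ⟨l, rfl⟩
    induction l using Fin.cases with
    | zero => exact ⟨j, by rw [Fin.cons_zero, Function.update_self]⟩
    | succ k => exact ⟨j.succAbove k, by rw [Fin.cons_succ, Function.update_of_ne (Fin.succAbove_ne j k)]⟩

include hc in
/-- **Rational point, II.**  At such a prime, `S_𝔴` has the residue field of `R`: every element of `S_𝔴` is
congruent to an element of `R` modulo `𝔪_{S_𝔴}`. [cite: StacksProject, Tag 052Q] -/
theorem exists_sub_mem_rational (j : Fin (d + 1)) (𝔴 : Ideal (chartRing c j)) [𝔴.IsPrime]
    (h𝔴 : 𝔴.comap (chartBase c j) = maximalIdeal R)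
    (L : Type) [CommRing L] [IsLocalRing L] (σ : R →+* L) (χ : chartRing c j →+* L)
    (hχ : ∀ r, χ (chartBase c j r) = σ r) (hloc : @IsLocalization.AtPrime _ _ L _ χ.toAlgebra 𝔴 _)
    (ŵ : Fin (d + 1) → R) (hcBw : ∀ k, chartGen c j k - chartBase c j (ŵ k) ∈ 𝔴) (l : L) :
    ∃ r : R, l - σ r ∈ maximalIdeal L := by
  letI alg : Algebra (chartRing c j) L := χ.toAlgebra
  haveI : IsLocalization.AtPrime L 𝔴 := hloc
  have halg : ∀ w, algebraMap (chartRing c j) L w = χ w := fun w => by rw [RingHom.algebraMap_toAlgebra]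
  have hχm : ∀ a ∈ 𝔴, χ a ∈ maximalIdeal L := fun a ha => by
    rw [← halg]; exact (IsLocalization.AtPrime.to_map_mem_maximal_iff L 𝔴 a).mpr ha
  have hχu : ∀ a ∉ 𝔴, IsUnit (χ a) := fun a ha => by
    rw [← halg]; exact IsLocalization.map_units L (⟨a, ha⟩ : 𝔴.primeCompl)
  have hKw : chartBase c j (c j) ∈ 𝔴 := by
    rw [← Ideal.mem_comap, h𝔴, ← hc]; exact Ideal.subset_span ⟨j, rfl⟩
  have hSres := exists_sub_chartBase_mem c j 𝔴 hKw ŵ hcBw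
  obtain ⟨a, b, rfl⟩ := IsLocalization.exists_mk'_eq 𝔴.primeCompl l
  obtain ⟨ra, hra⟩ := hSres a
  obtain ⟨rb, hrb⟩ := hSres b.1
  have hrbu : IsUnit rb := by
    by_contra hu
    have h1 : chartBase c j rb ∈ 𝔴 := by
      rw [← Ideal.mem_comap, h𝔴]; exact (IsLocalRing.mem_maximalIdeal _).mpr hu
    have h3 : (b : chartRing c j) = (b.1 - chartBase c j rb) + chartBase c j rb := by ring
    have h4 : (b.1 - chartBase c j rb) + chartBase c j rb ∈ 𝔴 := 𝔴.add_mem hrb h1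
    rw [← h3] at h4
    exact b.2 h4
  obtain ⟨rbi, hrbi⟩ := hrbu.exists_right_inv
  refine ⟨ra * rbi, ?_⟩
  have hbu : IsUnit (χ b.1 * σ rb) := (hχu _ b.2).mul (hrbu.map σ)
  refine (Ideal.mul_unit_mem_iff_mem _ hbu).mp ?_
  have e1 : IsLocalization.mk' L a b * χ b.1 = χ a := by
    rw [← halg, ← halg]; exact IsLocalization.mk'_spec L a b
  have e2 : σ rbi * σ rb = 1 := by rw [← map_mul, mul_comm, hrbi, map_one]
  have e3 : (IsLocalization.mk' L a b - σ (ra * rbi)) * (χ b.1 * σ rb) =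
      (χ a - σ ra) * σ rb - σ ra * (χ b.1 - σ rb) := by
    rw [map_mul]; linear_combination (σ rb) * e1 - (σ ra * χ b.1) * e2
  rw [e3]
  have ea := map_sub χ a (chartBase c j ra)
  have eb := map_sub χ b.1 (chartBase c j rb)
  refine (maximalIdeal L).sub_mem (Ideal.mul_mem_right _ _ ?_) (Ideal.mul_mem_left _ _ ?_)
  · rw [← hχ ra, ← ea]; exact hχm _ hra
  · rw [← hχ rb, ← eb]; exact hχm _ hrb

end RationalPoint

end Summit.ResolutionOfSingularities.ResolutionOfSingularities.Theorems.NearExit
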